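import Mathlib
import Literature.NumberTheory.Automorphic.GaussCellGL
import Summits.MatrixMultiplication.MatrixMultiplication.Theorems.GLnSeparatingDesignsBorderHalfDimensionDesignsStubLeadMinorLowerMul
import Summits.MatrixMultiplication.MatrixMultiplication.Theorems.GLnSeparatingDesignsBorderHalfDimensionDesignsStubLU
import Summits.MatrixMultiplication.MatrixMultiplication.Theorems.GLnSeparatingDesignsBorderHalfDimensionDesignsStubTranslate
import Summits.MatrixMultiplication.MatrixMultiplication.Theorems.GLnSeparatingDesignsBorderHalfDimensionDesignsStubCardSupport
import Summits.MatrixMultiplication.MatrixMultiplication.Theorems.GLnSeparatingDesignsBorderHalfDimensionDesignsStubIndicatorSpan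
import Summits.MatrixMultiplication.MatrixMultiplication.Theorems.GLnSeparatingDesignsBorderHalfDimensionDesignsStubCardStrictUpper
import Summits.MatrixMultiplication.MatrixMultiplication.Theorems.GLnSeparatingDesignsBorderHalfDimensionDesignsStubNumerics
import Summits.MatrixMultiplication.MatrixMultiplication.Theorems.GLnSeparatingDesignsBorderHalfDimensionDesignsStubUnipotentSpan

/-!
# `BorderHalfDimensionDesigns` (stmt-MatrixMultiplication-18360) — Negative lane for line `Sketch`:
# flag-minor hypersurface designs do not exist

Route `GLnSeparatingDesigns` (BlasiakCohnGrochowPrattUmans2024, arXiv:2410.14905, §4 p. 33 key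
question), crux `BorderHalfDimensionDesigns`, line `Sketch` (crux idea `split-torus-borel-pair`). The
line's hardest stub `C⁺ = FlagMinorHypersurfaceDesigns` (registered as `stub_flagMinorHypersurfaceDesigns`)
asks, for every `ε > 0`, for some `n ≥ 3` and, for every `δ > 0`, arbitrarily large `q`, a finite
`Y ⊆ GL_n(ℂ)` with `|Y| ≥ q^(n²/2 − εn)` and ONE polynomial `R ∈ ℂ[v₁,…,vₙ]` of total degree `≤ q^δ`
with `R(1,…,1) = 1` and `R(Δ₁(y⁻¹y')^q, …, Δₙ(y⁻¹y')^q) = 0` for all `y ≠ y'` in `Y`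
(`Δⱼ` = leading principal `j × j` minor). This file proves it is FALSE (registered negative stub
`stub_flagMinorHypersurfaceDesigns_false`), so the line dies at its hardest stub.

## Proof (a highest-weight span count, done with `LU` instead of representation theory)
Put `F(M) = R(Δ₁(M)^q,…,Δₙ(M)^q)`, so `F(y⁻¹y') = [y = y']` on `Y`, and `d = deg R`.
1. Generic left translation (`stub_exists_translate_leadMinor_ne_zero`): some `g ∈ GL_n(ℂ)` makes all
   leading minors of every `y⁻¹g` non-zero, so `y⁻¹g = m_y u_y` with `m_y` lower triangular and `u_y`
   upper unitriangular (`stub_lu_of_leadMinor_ne_zero`, from the tree's Gauss-cell file).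
2. `Δⱼ(m M) = Δⱼ(m) Δⱼ(M)` for lower-triangular `m` (`stub_leadMinor_lower_mul`), hence
   `F(y⁻¹y') = Σ_{μ ∈ supp R} c_μ χ_μ(m_y) f_μ(u_y M')`, `M' = g⁻¹y'`, `f_μ = Πⱼ Δⱼ^(q μⱼ)`.
3. `u ↦ f_μ(u M)` is a polynomial of total degree `≤ qnd` in the `n(n−1)/2` entries of `u`, so all the
   functions `M ↦ f_μ(u M)` lie in the span of `≤ (qnd+1)^(n(n−1)/2)` coefficient functions
   (`stub_unipotent_translate_span`, `stub_card_strictUpper`).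
4. The `|Y|` indicator functions therefore lie in a space spanned by `≤ |supp R|·(qnd+1)^(n(n−1)/2)
   ≤ (d+1)^n (qnd+1)^(n(n−1)/2)` functions (`stub_card_support_le`), and they are linearly independent:
   `|Y| ≤ (d+1)^n (qnd+1)^(n(n−1)/2)` (`stub_card_le_of_indicator_mem_span`).
5. With `ε = 1/4`, `d ≤ q^δ`, `δ = δ(n)` small and `q` large this is `< q^(n²/2 − n/4) ≤ |Y|`
   (`stub_numerics`) — contradiction.
The same count caps `|Y|` for EVERY `Y`-test that is a combination of `q^(O(δ))` left-`B⁻`-semi-invariant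
polynomials of degree `q^(1+δ)`: the "exact sandwich invariants" mechanism of the card loses exactly
the `n/2` torus dimensions that `BorderHalfDimensionDesigns` cannot afford. The crux itself is NOT
refuted here.
-/

set_option linter.dupNamespace false

open scoped MatrixGroups BigOperators
open Matrix OrderDual
open Literature.NumberTheory.Automorphic (leadMinor leadMinor_one)

namespace Summit.MatrixMultiplication.MatrixMultiplication.Theorems.BorderHalfDimensionDesigns

/-- **Flag-minor hypersurface designs do not exist** (`¬ C⁺`; registered negative stub of crux
`stmt-MatrixMultiplication-18360`, line `Sketch`): there is no family, for every `ε > 0`, of finite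
`Y ⊆ GL_n(ℂ)` of size `≥ q^(n²/2 − εn)` (`n ≥ 3` depending on `ε`; every `δ > 0`; `q → ∞`) together
with one `R ∈ ℂ[v₁,…,vₙ]` of total degree `≤ q^δ`, `R(1,…,1) = 1`, vanishing at
`(Δ₁(y⁻¹y')^q, …, Δₙ(y⁻¹y')^q)` for all `y ≠ y'` in `Y`. Indeed such an `R` forces
`|Y| ≤ (deg R + 1)^n (q n deg R + 1)^(n(n−1)/2)` (LU span count, see the module docstring), which is
`< q^(n²/2 − n/4)` for `ε = 1/4`, small `δ` and large `q`. -/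
theorem stub_flagMinorHypersurfaceDesigns_false :
    ¬ (∀ ε : ℝ, 0 < ε → ∃ n : ℕ, 3 ≤ n ∧ ∀ δ : ℝ, 0 < δ → ∀ q₀ : ℕ, ∃ q : ℕ, q₀ ≤ q ∧
      ∃ Y : Finset (Matrix.GeneralLinearGroup (Fin n) ℂ), ∃ R : MvPolynomial (Fin n) ℂ,
        (q : ℝ) ^ ((n : ℝ) ^ 2 / 2 - ε * n) ≤ (Y.card : ℝ) ∧
        (R.totalDegree : ℝ) ≤ (q : ℝ) ^ δ ∧
        MvPolynomial.eval (fun _ => (1 : ℂ)) R = 1 ∧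
        ∀ y ∈ Y, ∀ y' ∈ Y, y ≠ y' →
          MvPolynomial.eval (fun j : Fin n =>
            (Literature.NumberTheory.Automorphic.leadMinor Fin.castSucc
              ((y⁻¹ * y' : Matrix.GeneralLinearGroup (Fin n) ℂ) : Matrix (Fin n) (Fin n) ℂ) j.succ) ^ q) R = 0) := by
  intro h
  obtain ⟨n, hn3, hnall⟩ := h (1 / 4) (by norm_num)
  obtain ⟨δ, hδ, q₀, hnum⟩ := stub_numerics n hn3
  obtain ⟨q, hq₀q, Y, R, hcard, hdeg, hR1, hvan⟩ := hnall δ hδ q₀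
  generalize hd : R.totalDegree = d at hdeg
  -- generic translation and LU factors
  obtain ⟨g, hg⟩ := stub_exists_translate_leadMinor_ne_zero Y
  have hLU : ∀ y ∈ Y, ∃ m u : Matrix (Fin n) (Fin n) ℂ,
      m.BlockTriangular (fun i : Fin n => OrderDual.toDual (Fin.castSucc i)) ∧
      u.BlockTriangular Fin.castSucc ∧ (∀ i, u i i = 1) ∧
      ((y⁻¹ * g : Matrix.GeneralLinearGroup (Fin n) ℂ) : Matrix (Fin n) (Fin n) ℂ) = m * u :=
    fun y hy => stub_lu_of_leadMinor_ne_zero _ (hg y hy)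
  choose! m u hm hu hu1 hmu using hLU
  -- the spanning family, indexed by `κ = supp R × ({p : Fin n × Fin n // p.1 < p.2} → Fin (qnd+1))`
  have hμd : ∀ μ : R.support, ∑ j, (μ : Fin n →₀ ℕ) j ≤ d := by
    intro μ
    have h1 := MvPolynomial.le_totalDegree (p := R) μ.2
    rw [Finsupp.sum_fintype _ _ (fun _ => rfl), hd] at h1
    exact h1
  have H4 : ∀ μ : R.support, ∃ G : ({p : Fin n × Fin n // p.1 < p.2} → Fin (q * n * d + 1)) → Matrix (Fin n) (Fin n) ℂ → ℂ,
      ∀ u : Matrix (Fin n) (Fin n) ℂ, u.BlockTriangular Fin.castSucc → (∀ i, u i i = 1) →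
        ∃ c : ({p : Fin n × Fin n // p.1 < p.2} → Fin (q * n * d + 1)) → ℂ, ∀ M : Matrix (Fin n) (Fin n) ℂ,
          (∏ j : Fin n, (leadMinor Fin.castSucc (u * M) j.succ) ^ (q * (μ : Fin n →₀ ℕ) j))
            = ∑ β, c β * G β M :=
    fun μ => stub_unipotent_translate_span q d (fun j => (μ : Fin n →₀ ℕ) j) (hμd μ)
  choose G hG using H4
  have H4' : ∀ μ : R.support, ∀ y ∈ Y, ∃ c : ({p : Fin n × Fin n // p.1 < p.2} → Fin (q * n * d + 1)) → ℂ,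
      ∀ M : Matrix (Fin n) (Fin n) ℂ,
        (∏ j : Fin n, (leadMinor Fin.castSucc (u y * M) j.succ) ^ (q * (μ : Fin n →₀ ℕ) j))
          = ∑ β, c β * G μ β M :=
    fun μ y hy => hG μ (u y) (hu y hy) (hu1 y hy)
  choose! c hc using H4'
  -- the character values `χ_μ(m_y) = Π Δⱼ(m_y)^(q μⱼ)`
  set χ : R.support → Matrix.GeneralLinearGroup (Fin n) ℂ → ℂ := fun μ y =>
    ∏ j : Fin n, (leadMinor Fin.castSucc (m y) j.succ) ^ (q * (μ : Fin n →₀ ℕ) j) with hχ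
  -- indicators of points of `Y` lie in the span of `G' (μ, β) := y' ↦ G μ β (g⁻¹ y')`
  have key : ∀ y : Y,
      ∃ C : R.support × ({p : Fin n × Fin n // p.1 < p.2} → Fin (q * n * d + 1)) → ℂ,
        ∀ y' : Y,
          (if y' = y then (1 : ℂ) else 0) =
            ∑ k, C k * G k.1 k.2 ((g⁻¹ * (y' : Matrix.GeneralLinearGroup (Fin n) ℂ) :
              Matrix.GeneralLinearGroup (Fin n) ℂ) : Matrix (Fin n) (Fin n) ℂ) := by
    intro y
    refine ⟨fun k => R.coeff k.1 * χ k.1 y * c k.1 y k.2, fun y' => ?_⟩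
    set M' : Matrix (Fin n) (Fin n) ℂ := ((g⁻¹ * (y' : Matrix.GeneralLinearGroup (Fin n) ℂ) :
      Matrix.GeneralLinearGroup (Fin n) ℂ) : Matrix (Fin n) (Fin n) ℂ) with hM'
    -- regroup the double sum
    have step1 : ∑ k : R.support × ({p : Fin n × Fin n // p.1 < p.2} → Fin (q * n * d + 1)),
        R.coeff k.1 * χ k.1 y * c k.1 y k.2 * G k.1 k.2 M' =
        ∑ μ : R.support, R.coeff μ * (χ μ y * ∑ β, c μ y β * G μ β M') := by
      rw [Fintype.sum_prod_type]
      refine Finset.sum_congr rfl fun μ _ => ?_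
      rw [Finset.mul_sum, Finset.mul_sum]
      refine Finset.sum_congr rfl fun β _ => ?_
      ring
    -- the product over `Y`'s LU factors recombines to `Δⱼ(y⁻¹ y')`
    have step2 : ∀ μ : R.support, χ μ y * ∑ β, c μ y β * G μ β M' =
        ∏ j : Fin n, (leadMinor Fin.castSucc
          (((y : Matrix.GeneralLinearGroup (Fin n) ℂ)⁻¹ * (y' : Matrix.GeneralLinearGroup (Fin n) ℂ) :
            Matrix.GeneralLinearGroup (Fin n) ℂ) : Matrix (Fin n) (Fin n) ℂ) j.succ ^ q) ^
            ((μ : Fin n →₀ ℕ) j) := by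
      intro μ
      rw [← hc μ y y.2 M', hχ]
      simp only
      rw [← Finset.prod_mul_distrib]
      refine Finset.prod_congr rfl fun j _ => ?_
      rw [← mul_pow, ← stub_leadMinor_lower_mul _ _ (hm y y.2), ← Matrix.mul_assoc, ← hmu y y.2,
        hM', ← Units.val_mul, ← pow_mul]
      congr 3
      group
    rw [step1]
    simp_rw [step2]
    rw [Finset.sum_coe_sort R.support (fun μ => R.coeff μ * ∏ j : Fin n, (leadMinor Fin.castSucc
          (((y : Matrix.GeneralLinearGroup (Fin n) ℂ)⁻¹ * (y' : Matrix.GeneralLinearGroup (Fin n) ℂ) :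
            Matrix.GeneralLinearGroup (Fin n) ℂ) : Matrix (Fin n) (Fin n) ℂ) j.succ ^ q) ^ (μ j)),
      ← MvPolynomial.eval_eq']
    by_cases hyy : y' = y
    · subst hyy
      rw [if_pos rfl, inv_mul_cancel, Units.val_one]
      simp only [leadMinor_one, one_pow]
      exact hR1.symm
    · rw [if_neg hyy]
      have hne : (y : Matrix.GeneralLinearGroup (Fin n) ℂ) ≠ y' := fun h => hyy (Subtype.ext h).symm
      exact (hvan y y.2 y' y'.2 hne).symm
  have hle := stub_card_le_of_indicator_mem_span
    (ι := Y)
    (fun (k : R.support × ({p : Fin n × Fin n // p.1 < p.2} → Fin (q * n * d + 1)))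
      (y' : Y) =>
      G k.1 k.2 ((g⁻¹ * (y' : Matrix.GeneralLinearGroup (Fin n) ℂ) :
        Matrix.GeneralLinearGroup (Fin n) ℂ) : Matrix (Fin n) (Fin n) ℂ)) key
  -- count
  simp only [Fintype.card_prod, Fintype.card_coe, Fintype.card_fun, Fintype.card_fin,
    stub_card_strictUpper] at hle
  have hsupp : R.support.card ≤ (d + 1) ^ n := stub_card_support_le R hd.le
  have hY : Y.card ≤ (d + 1) ^ n * (q * n * d + 1) ^ (n * (n - 1) / 2) :=
    hle.trans (Nat.mul_le_mul_right _ hsupp)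
  have hnum' := hnum q hq₀q d hdeg
  have h1 : (Y.card : ℝ) ≤ (((d + 1) ^ n * (q * n * d + 1) ^ (n * (n - 1) / 2) : ℕ) : ℝ) := by
    exact_mod_cast hY
  have h2 : (q : ℝ) ^ ((n : ℝ) ^ 2 / 2 - 1 / 4 * (n : ℝ)) ≤ (Y.card : ℝ) := hcard
  linarith


end Summit.MatrixMultiplication.MatrixMultiplication.Theorems.BorderHalfDimensionDesigns
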